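import Literature.MathematicalPhysics.QuantumFieldTheory.Balaban1983to89.Beta.PrefixAbsorption
import Summits.QuantumFields.BalabanUV.Gaps.CapTailFloors

/-!
# Gaps / CapSignsNecessaryFineWitness — the early-scale sign necessity is EXACTLY the coarse-lattice content of the typed (0.31): a split meeting
# EVERY near-zero control, with `β⁰_1 < 0`, whose constructions satisfy (0.31) on all lattices `K ≥ 2` yet NOT [I] Theorem 2 as typed (∀ K)
# (cell pub-balaban-gaps, seat g1-p3 gen 3, CAP+tail «split ∕ weakening» charge; witness companion of `Gaps/CapSignsNecessary` (N1) and
# `Gaps/CapSignsNecessaryFine`)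

HONEST FRAMING (cell rule, page 1 of everything): bookkeeping over the β sub-cell's hypothesis carriers with ONE explicit toy family; NOTHING of
Bałaban's is asserted beyond print; the family is NOT Bałaban's β (1.22) — it is a kernel witness about which HYPOTHESIS SHAPES imply what; 0 binders
discharged; NOT `BetaPertH`, NOT the continuum limit, NOT Clay.  HONEST DEPENDENCY (b2b cell, verbatim): «continuum YM on T⁴ ⇐ BetaPertH ∧ nine
spine estimates (0/9 proved); BetaPertH ⇐ (D1) ∧ (D4) ∧ CAP+tail; G-an2-4 gates asym, D1 and NE2/3/4.»

CONTENT.  The history-independent family `earlyNegBeta`: `β_1 ≡ −1/2`, `β_{k+1} ≡ 1` for `k ≥ 1` (its unique split has `β⁰_1 = −1/2 < 0`, `β¹ ≡ 0`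
— so EVERY near-zero control of `Gaps/CapSignsNecessary` holds: `RemainderConst S γ 0`, `EverySlope`, (AF-1) with `C_r = 0`, continuity on
closed boxes).  §2 `not_thm2Printed_earlyNeg`: NO forward-generated construction (halting, curried) satisfies `B12.Thm2Printed C L`, `L > 1`
(the tree's `Beta.PrefixAbsorption.first_beta_pos_of_thm2Printed`: the lattice `K = 1`).  §3 **`fineClause_earlyNeg`**: yet EVERY forward-generated
construction satisfies the FINE-LATTICE clause of `Gaps/CapSignsNecessaryFine` with `K₀ = 2` — for every `m`, `γ > 0`, `g ∈ ]0,γ]`, `L > 1`, and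
every `K ≥ 2` a bare coupling whose run stays in `]0,γ]`, ends at `g_K = g`, solves the history recursion and obeys the two-sided (0.31) with
`β = 1/(4 log L)`, `β′ = 1/log L` (explicit solution `g_k = (1/g² + Σ_{j∈[k,K)} β_j)^{-1/2}`, forward uniqueness `FlowStepRuns.flow_eq_of_rgEqH`).
So the reading caveat is sharp: «`0 ≤ β⁰_{k+1}` at EARLY `k`» follows from the typed ∀-K statement and NOT from its fine-lattice form, while
`Gaps/CapSignsNecessaryFine` shows everything else survives.  All [folklore]; 0 sorry; 4 `def`s (the coefficient sequence `coeff`, the toy family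
`earlyNegBeta`, its split `earlyNegSplit`, the explicit solution `sol`); nothing about Bałaban's objects.
-/

namespace Summit.QuantumFields.BalabanUV.Gaps.CapSignsNecessaryFineWitness

open Literature.MathematicalPhysics.QuantumFieldTheory.Balaban1983to89
open Literature.MathematicalPhysics.QuantumFieldTheory.Balaban1983to89.FlowStep
open Literature.MathematicalPhysics.QuantumFieldTheory.Balaban1983to89.FlowStepRuns
open Literature.MathematicalPhysics.QuantumFieldTheory.Balaban1983to89.DagBinding
open Literature.MathematicalPhysics.QuantumFieldTheory.Balaban1983to89.Beta.RemainderChain (RemainderConst)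
open Literature.MathematicalPhysics.QuantumFieldTheory.Balaban1983to89.Beta.PrefixAbsorption (first_beta_pos_of_thm2Printed)
open Summit.QuantumFields.BalabanUV.Gaps.CapSignsConstRoad (EverySlope)

noncomputable section

/-! ## §1 The family and its split -/

/-- The coefficient sequence: `b_0 = −1/2`, `b_j = 1` for `j ≥ 1`. [folklore] -/
def coeff (j : ℕ) : ℝ := if j = 0 then -(1 / 2) else 1

/-- The history-independent family `β_{k+1}(g_0,…,g_k) := coeff k`. [folklore] -/
def earlyNegBeta : HBeta := fun k _ => coeff k

/-- Its (unique) printed split: `β⁰_{k+1} = coeff k`, `β¹ ≡ 0`. [folklore] -/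
def earlyNegSplit : B12Beta.OneLoopSplit earlyNegBeta where
  β0 := coeff
  β1 _ _ := 0
  split _ _ := by simp [earlyNegBeta]
  vanish _ _ _ := rfl

/-- `β⁰_1 = −1/2 < 0`. [folklore] -/
theorem earlyNegSplit_beta0_zero_neg : earlyNegSplit.β0 0 < 0 := by
  show coeff 0 < 0
  norm_num [coeff]

/-- Every near-zero control holds trivially: the remainder is identically `0` (`RemainderConst S γ 0` on every box). [folklore] -/
theorem remainderConst_earlyNeg (γ : ℝ) : RemainderConst earlyNegSplit γ 0 := fun _ _ _ => by
  show |(0 : ℝ)| ≤ 0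
  simp

/-- Hence `EverySlope` on every reference box. [folklore] -/
theorem everySlope_earlyNeg {γc : ℝ} (hγc : 0 < γc) : EverySlope earlyNegSplit γc := fun _ hs =>
  ⟨γc, hγc, le_rfl, fun k p hp => (remainderConst_earlyNeg γc k p hp).trans hs.le⟩

/-- … and the scale-wise smallness hypothesis `hR` of `CapSignsNecessary.beta0_nonneg_of_thm2Printed`. [folklore] -/
theorem smallAtZero_earlyNeg :
    ∀ (k : ℕ) (ε : ℝ), 0 < ε → ∃ γ : ℝ, 0 < γ ∧ ∀ p ∈ B12Beta.HistBox γ k, |earlyNegSplit.β1 k p| ≤ ε :=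
  fun k _ hε => ⟨1, one_pos, fun p hp => (remainderConst_earlyNeg 1 k p hp).trans hε.le⟩

/-! ## §2 The typed ∀-K Theorem 2 FAILS (coarse lattice `K = 1`) -/

/-- NO forward-generated construction (halting outside, curried) of the family satisfies [I] Theorem 2 as typed, for any `L > 1`: on the lattice
`K = 1`, `β_1 = −1/2 < 0` (`Beta.PrefixAbsorption.first_beta_pos_of_thm2Printed`). [cite: Balaban1987RG1, Thm 2 (0.31) p.259] -/
theorem not_thm2Printed_earlyNeg {C : B12.Construction} (hgen : ForwardGenerated C earlyNegBeta)
    (hhalt : HaltsOutside C earlyNegBeta) (hcur : CurriesHBeta C earlyNegBeta) {L : ℝ} (hL : 1 < L) :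
    ¬ B12.Thm2Printed C L := by
  intro h
  obtain ⟨g0, -, hpos⟩ := first_beta_pos_of_thm2Printed hgen hhalt hcur hL h 0
  have : earlyNegBeta 0 (prefixOf (C ⟨1, 0, g0⟩).flow.g 0) = -(1 / 2) := by simp [earlyNegBeta, coeff]
  linarith

/-! ## §3 The FINE-LATTICE clause HOLDS with `K₀ = 2` -/

/-- The suffix sums `S_k = Σ_{j∈[k,K)} coeff j`: `= K − k` for `k ≥ 1`, `= K − 3/2` for `k = 0 < K`. [folklore] -/
theorem suffix_eq {K k : ℕ} (hk : k ≤ K) :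
    ∑ j ∈ Finset.Ico k K, coeff j = if k = 0 ∧ 0 < K then (K : ℝ) - 3 / 2 else (K : ℝ) - k := by
  by_cases hk0 : k = 0
  · subst hk0
    rcases Nat.eq_zero_or_pos K with hK | hK
    · subst hK; simp
    · rw [if_pos ⟨rfl, hK⟩, Finset.sum_eq_sum_Ico_succ_bot hK]
      have h1 : ∑ j ∈ Finset.Ico (0 + 1) K, coeff j = ∑ j ∈ Finset.Ico (0 + 1) K, (1 : ℝ) :=
        Finset.sum_congr rfl fun j hj => by
          have : j ≠ 0 := by have := (Finset.mem_Ico.mp hj).1; omega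
          simp [coeff, this]
      rw [h1, Finset.sum_const, Nat.card_Ico, nsmul_eq_mul, mul_one]
      have : ((K - (0 + 1) : ℕ) : ℝ) = (K : ℝ) - 1 := by
        rw [Nat.cast_sub (by omega)]; push_cast; ring
      rw [this]; simp [coeff]; ring
  · rw [if_neg (fun h => hk0 h.1)]
    have h1 : ∑ j ∈ Finset.Ico k K, coeff j = ∑ j ∈ Finset.Ico k K, (1 : ℝ) :=
      Finset.sum_congr rfl fun j hj => by
        have : j ≠ 0 := by have := (Finset.mem_Ico.mp hj).1; omega
        simp [coeff, this]
    rw [h1, Finset.sum_const, Nat.card_Ico, nsmul_eq_mul, mul_one, Nat.cast_sub hk]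

/-- The explicit solution `g_k = (1/g² + S_k)^{-1/2}` of the history recursion ending at `g_K = g`. [folklore] -/
def sol (g : ℝ) (K k : ℕ) : ℝ := 1 / Real.sqrt (1 / g ^ 2 + ∑ j ∈ Finset.Ico k K, coeff j)

/-- For `K ≥ 2` the radicand is positive: `1/g² + S_k ≥ 1/g² + 1/2`. [folklore] -/
theorem radicand_pos {g : ℝ} (hg : 0 < g) {K k : ℕ} (hK : 2 ≤ K) (hk : k ≤ K) :
    1 / g ^ 2 ≤ 1 / g ^ 2 + ∑ j ∈ Finset.Ico k K, coeff j ∧ 0 < 1 / g ^ 2 + ∑ j ∈ Finset.Ico k K, coeff j := by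
  have hg2 : 0 < 1 / g ^ 2 := by positivity
  have hS : 0 ≤ ∑ j ∈ Finset.Ico k K, coeff j := by
    rw [suffix_eq hk]
    split_ifs with h
    · have : (2 : ℝ) ≤ K := by exact_mod_cast hK
      linarith
    · have : (k : ℝ) ≤ K := by exact_mod_cast hk
      linarith
  exact ⟨by linarith, by linarith⟩

/-- `sol` is positive and `1/sol_k² = 1/g² + S_k` (`K ≥ 2`). [folklore] -/
theorem sol_pos_and_inv_sq {g : ℝ} (hg : 0 < g) {K k : ℕ} (hK : 2 ≤ K) (hk : k ≤ K) :
    0 < sol g K k ∧ 1 / (sol g K k) ^ 2 = 1 / g ^ 2 + ∑ j ∈ Finset.Ico k K, coeff j := by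
  obtain ⟨-, hpos⟩ := radicand_pos hg hK hk
  have hsq : 0 < Real.sqrt (1 / g ^ 2 + ∑ j ∈ Finset.Ico k K, coeff j) := Real.sqrt_pos.mpr hpos
  refine ⟨by unfold sol; positivity, ?_⟩
  have h2 : (sol g K k) ^ 2 = 1 / (1 / g ^ 2 + ∑ j ∈ Finset.Ico k K, coeff j) := by
    unfold sol
    rw [div_pow, one_pow, Real.sq_sqrt hpos.le]
  rw [h2, one_div_one_div]

/-- `sol_K = g`. [folklore] -/
theorem sol_end {g : ℝ} (hg : 0 < g) (K : ℕ) : sol g K K = g := by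
  unfold sol
  rw [Finset.Ico_self, Finset.sum_empty, add_zero, one_div (g ^ 2), ← inv_pow, Real.sqrt_sq (inv_nonneg.mpr hg.le),
    one_div, inv_inv]

/-- `sol` solves the history recursion of the family up to `K` (`K ≥ 2`). [folklore] -/
theorem sol_rgEqH {g : ℝ} (hg : 0 < g) {K : ℕ} (hK : 2 ≤ K) : RGEqH K earlyNegBeta (sol g K) := by
  intro k hk
  rw [(sol_pos_and_inv_sq hg hK hk.le).2, (sol_pos_and_inv_sq hg hK hk).2, Finset.sum_eq_sum_Ico_succ_bot hk]
  show _ = _ + coeff k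
  ring

/-- `sol_k ≤ g` (the radicand is `≥ 1/g²`). [folklore] -/
theorem sol_le {g : ℝ} (hg : 0 < g) {K k : ℕ} (hK : 2 ≤ K) (hk : k ≤ K) : sol g K k ≤ g := by
  obtain ⟨hpos, hinv⟩ := sol_pos_and_inv_sq hg hK hk
  obtain ⟨hge, -⟩ := radicand_pos hg hK hk
  rw [← hinv] at hge
  -- 1/g² ≤ 1/sol² ⟹ sol² ≤ g² ⟹ sol ≤ g
  have h1 : (sol g K k) ^ 2 ≤ g ^ 2 := by
    have hs2 : 0 < (sol g K k) ^ 2 := by positivity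
    have hg2 : 0 < g ^ 2 := by positivity
    rw [div_le_div_iff₀ hg2 hs2] at hge
    linarith
  exact (pow_le_pow_iff_left₀ hpos.le hg.le two_ne_zero).mp h1

/-- **THE FINE-LATTICE CLAUSE HOLDS WITH `K₀ = 2`** for every forward-generated construction of the family: for every `m`, `γ > 0`, `g ∈ ]0,γ]`,
`L > 1` and every `K ≥ 2`, the bare coupling `g₀ = sol_0` gives a run in `]0,γ]` ending at `g_K = g`, solving the history recursion, with the
two-sided (0.31) for `β = (1/4)/log L`, `β′ = 1/log L` — although `β⁰_1 = −1/2 < 0` and the typed ∀-K Theorem 2 fails (`not_thm2Printed_earlyNeg`).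
[cite: Balaban1987RG1, Thm 2 (0.31) p.259] -/
theorem fineClause_earlyNeg {C : B12.Construction} (hgen : ForwardGenerated C earlyNegBeta) (m : ℕ) {γ g L : ℝ}
    (hg : 0 < g) (hgγ : g ≤ γ) (hL : 1 < L) :
    ∀ K : ℕ, 2 ≤ K → ∃ g0 : ℝ, (C ⟨K, m, g0⟩).flow.InInterval γ K ∧ (C ⟨K, m, g0⟩).flow.g K = g ∧
      RGEqH K earlyNegBeta (C ⟨K, m, g0⟩).flow.g ∧ ∀ k, k ≤ K →
        1 / g ^ 2 + (1 / 4) / Real.log L * (((K : ℝ) - k) * Real.log L) ≤ 1 / ((C ⟨K, m, g0⟩).flow.g k) ^ 2 ∧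
        1 / ((C ⟨K, m, g0⟩).flow.g k) ^ 2 ≤ 1 / g ^ 2 + 1 / Real.log L * (((K : ℝ) - k) * Real.log L) := by
  intro K hK
  have hrg := sol_rgEqH hg hK
  have hpos : ∀ k, k ≤ K → 0 < sol g K k := fun k hk => (sol_pos_and_inv_sq hg hK hk).1
  have heq : ∀ k, k ≤ K → (C ⟨K, m, sol g K 0⟩).flow.g k = sol g K k :=
    flow_eq_of_rgEqH (C ⟨K, m, sol g K 0⟩).flow earlyNegBeta K (fun k hk => hgen.2 ⟨K, m, sol g K 0⟩ k hk)
      (hgen.1 ⟨K, m, sol g K 0⟩) hrg hpos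
  refine ⟨sol g K 0, fun k hk => ?_, ?_, fun k hk => ?_, fun k hk => ?_⟩
  · rw [heq k hk]; exact ⟨hpos k hk, (sol_le hg hK hk).trans hgγ⟩
  · rw [heq K le_rfl]; exact sol_end hg K
  · -- the family is history-independent, so the recursion transfers verbatim
    have h := hrg k hk
    rw [heq k hk.le, heq (k + 1) hk]
    simpa [earlyNegBeta] using h
  · rw [heq k hk, (sol_pos_and_inv_sq hg hK hk).2, coeff_logL _ _ _ hL, coeff_logL _ _ _ hL, suffix_eq hk]
    have hK' : (2 : ℝ) ≤ K := by exact_mod_cast hK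
    have hk' : (k : ℝ) ≤ K := by exact_mod_cast hk
    split_ifs with h
    · obtain ⟨rfl, -⟩ := h
      push_cast
      constructor <;> linarith
    · constructor <;> linarith

/-- **CENSUS FORM**: a history family whose unique split has `β⁰_1 < 0`, remainder identically `0` (so every near-zero control of
`Gaps/CapSignsNecessary` holds), for which NO forward-generated construction satisfies [I] Theorem 2 as typed (∀ K), yet its canonical
construction `FlowStepRuns.modelOf` satisfies the fine-lattice (0.31) clause for all `K ≥ 2` (every `m`, box, admissible `g`, `L > 1`).  So the
early-scale sign necessity (N1) is tied EXACTLY to the coarse lattices of the typed statement. [folklore] -/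
theorem earlySign_necessity_is_coarse :
    ∃ (β : HBeta) (S : B12Beta.OneLoopSplit β), S.β0 0 < 0 ∧ (∀ γ : ℝ, RemainderConst S γ 0) ∧
      (∀ L : ℝ, 1 < L → ¬ B12.Thm2Printed (modelOf β) L) ∧
      ∀ (m : ℕ) (γ g L : ℝ), 0 < g → g ≤ γ → 1 < L → ∀ K : ℕ, 2 ≤ K → ∃ g0 : ℝ,
        ((modelOf β) ⟨K, m, g0⟩).flow.InInterval γ K ∧ ((modelOf β) ⟨K, m, g0⟩).flow.g K = g ∧
        RGEqH K β ((modelOf β) ⟨K, m, g0⟩).flow.g ∧ ∀ k, k ≤ K →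
          1 / g ^ 2 + (1 / 4) / Real.log L * (((K : ℝ) - k) * Real.log L) ≤ 1 / (((modelOf β) ⟨K, m, g0⟩).flow.g k) ^ 2 ∧
          1 / (((modelOf β) ⟨K, m, g0⟩).flow.g k) ^ 2 ≤ 1 / g ^ 2 + 1 / Real.log L * (((K : ℝ) - k) * Real.log L) :=
  ⟨earlyNegBeta, earlyNegSplit, earlyNegSplit_beta0_zero_neg, remainderConst_earlyNeg,
    fun _ hL => not_thm2Printed_earlyNeg (modelOf_forwardGenerated _) (modelOf_haltsOutside _) (modelOf_curries _) hL,
    fun m _ _ _ hg hgγ hL => fineClause_earlyNeg (modelOf_forwardGenerated _) m hg hgγ hL⟩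

end

end Summit.QuantumFields.BalabanUV.Gaps.CapSignsNecessaryFineWitness
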